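import Summits.BirchSwinnertonDyer.BirchSwinnertonDyer.Theorems.PrintX9MuPartStabilizedWeakLetters
import HarnessLib

/-!
# The WITNESS INTERFACE for the shared μ-residual of rows 9/10 (`MuPartStabilizedOfPrint`): what a
# specialised-Kolyvagin-system port must deliver at ONE Eisenstein prime `q_m = T^m + p` (`SpecWitness`),
# and the frame-free statement `SpecWitnessesFrameFree` (definitions file)

Cell `pub/bsd-print-x9`, seat `bsd-line-x9-p1-w2` (g4), for the μ-LEAD lineage `bsd-line-x9-p1` (crux
stmt-BirchSwinnertonDyer-27077, skeleton v7: ONE stub = the shared letter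
`HeegnerMuPartStabilized.MuPartStabilizedOfPrint`, p625984) and its row-10 twins (27275 / 23055).
DEFINITIONS WITH BODIES + one unfolding lemma; NOTHING is asserted, no named fact, no instance, no `sorry`.
ROUTE-INDEPENDENT (imports no `Theses` file). TRANSCRIBED into the importable tree from the crux-ideation
workfile `Cruxes/HowardContainmentAnyClassNumberX10b/Lines/specialise_first_mu_x10b.lean` §6/§8 (seat
bsd-idea-16 g4, card `specialise-first-mu-x10b` v7; Cruxes workfiles cannot be imported by `Theorems` files),
with the field list VERBATIM and docstrings added; design credit: bsd-idea-16.

WHAT.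
* `SpecWitness R S X L q c` — D1/D2-shaped abstract data at one prime `q`: a compact specialised Selmer
  module `H` (killed by `q`) receiving `𝔖 = S` by a control map `f` with cokernel of CARDINALITY `≤ c` and
  carrying a class `κ₁` with `f(L) ⊆ R∙κ₁` (`L = Λκ_∞(C)`); the dual specialised module `Xq` receiving
  `𝒳/q𝒳` by a control map `h` with kernel of CARDINALITY `≤ c`; and the ERROR-FREE DVR Kolyvagin bound in
  structure form `#Xq_tors ≤ #(H/R∙κ₁)²` [Howard 2004, Thm. 1.6.1 / proof of Thm. 2.2.10 at `𝔮 = T^m + p`;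
  Mastella–Zerman 2026, Thm. 2.40: `H¹_ℒ(K, 𝐀) ≅ Φ/𝓡 ⊕ M ⊕ M`, `ℓ(M) ≤ ℓ(H¹_ℒ(K,𝐓)/𝓡κ(1))`]. This is NOT a
  definition of those Selmer modules (definition requests D1/D2 of the card); it is the interface through
  which the frame-free K1 inequality (`muPartStabilizedOfPrint_of_card_quotSMulTop_qm_le`, p626469)
  consumes them. Design constraint it encodes (idea-16 g4): control errors enter ONLY through the
  CARDINALITY of `coker f` / `ker h` — an error merely annihilated by `p^c` has `S_m`-length `c·m` at
  `S_m = Λ/(q_m)` and would survive `÷ m` in the μ-inequality.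
* `quotSMulTopMap I N : N/I•N → X/I•X` — the natural map (plumbing for lemma L0 of the proofs file).
* `HasSpecWitnesses p S X L : Prop` — the POINTWISE, frame-free, module-level predicate «for all large `m`
  there is a `SpecWitness` at `q_m = T^m + p` with constant `p^c`, `c` uniform in `m`» (bsd-idea-16 g5's cut:
  the interface is cut pointwise, not per letter); the sibling proofs file proves the ONE pointwise theorem
  `lengthAt_torsion_le_two_mul_of_hasSpecWitnesses` (⟹ `length_(p)(X_tors) ≤ 2·length_(p)(S/L)`).
* three quantifier SHELLS over it, one per candidate letter of the shared item (plan g10 installs one):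
  `SpecWitnessesFrameFree` (prefix of the `∀ C` letter `MuPartStabilizedOfPrint`, p625984),
  `SpecWitnessesCoherentPair` (prefix + engine binders + exported coherent pair of the L∃ letter
  `MuPartStabilizedCoherentPair`, p630902 — ENDORSED by the μ-LEAD x9-p1 g2 11:53:02Z) and
  `SpecWitnessesPrincipal` (prefix + principal-system binders of the LP letter `MuPartStabilizedPrincipal`,
  p630902); the proofs file proves `shell → letter` for all three, so ONE `SpecWitness` construction (D1: S1
  cardinality-bounded control at `q_m` + S2 error-free DVR bound, run on the port's own principal system)
  closes whichever letter is installed, for rows 9 AND 10.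
«beyond-print theorem»: no (nothing is proved here). BSD is NOT proved by this file; no summit statement is
proved by this seat.

References: [Howard2004HeegnerKolyvagin] Compositio Math. 140 (2004), Thm. 1.6.1, Lemma 2.2.7, Prop. 2.2.8,
proof of Thm. 2.2.10; [MastellaZerman2026] arXiv:2505.08710, Thm. 2.40, Thm. 3.15; [MazurRubin2004KolyvaginSystems]
Mem. AMS 799, Thm. 5.2.2 and §5.3; crux card `Cruxes/HowardContainmentAnyClassNumberX10b/Lines/specialise-first-mu-x10b.md`.
-/

set_option linter.dupNamespace false
set_option autoImplicit false

noncomputable section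

open scoped Classical Pointwise
open Literature Literature.NumberTheory.EllipticCurves WeierstrassCurve

namespace Summit.BirchSwinnertonDyer.BirchSwinnertonDyer.Theorems.HeegnerMuPartStabilized

universe u v w

/-! ## The natural map `N/I•N → X/I•X` -/

section Plumbing

variable {R : Type*} [CommRing R]

/-- The natural map `N ⧸ I•N → X ⧸ I•X` induced by the inclusion of a submodule `N ≤ X` (plumbing `def`
for lemma L0 «`𝒳_tors/q ↪ 𝒳/q`» of the proofs file). [folklore] -/
def quotSMulTopMap (I : Ideal R) {X : Type*} [AddCommGroup X] [Module R X] (N : Submodule R X) :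
    (N ⧸ (I • (⊤ : Submodule R N))) →ₗ[R] (X ⧸ (I • (⊤ : Submodule R X))) :=
  Submodule.mapQ _ _ N.subtype (Submodule.map_le_iff_le_comap.1 (by
    rw [Submodule.map_smul'', Submodule.map_top, Submodule.range_subtype]
    exact Submodule.smul_mono le_rfl le_top))

/-- Unfolding: `quotSMulTopMap I N [n] = [n]`. [folklore] -/
@[simp]
theorem quotSMulTopMap_mk (I : Ideal R) {X : Type*} [AddCommGroup X] [Module R X]
    (N : Submodule R X) (n : N) :
    quotSMulTopMap I N (Submodule.Quotient.mk n) = Submodule.Quotient.mk (n : X) :=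
  rfl

end Plumbing

/-! ## The witness interface at one prime `q` -/

/-- **Witness data for the specialised Kolyvagin bound at one prime `q`** (D1/D2-shaped abstract data;
transcribed from bsd-idea-16's card `specialise-first-mu-x10b` v7 §6). For a coefficient ring `R` (`= Λ`),
modules `S` (`= 𝔖`, the `Λ`-adic Selmer module), `X` (`= 𝒳`, the Selmer dual), a submodule `L ≤ S`
(`= Λκ_∞(C)`), an element `q` (`= q_m = T^m + p`) and a constant `c`: a compact specialised Selmer module
`H` killed by `q` with a control map `f : S → H` whose cokernel has cardinality `≤ c`, a class `κ₁ ∈ H`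
with `f(L) ⊆ R∙κ₁`; a dual specialised module `Xq` with a control map `h : X/qX → Xq` whose kernel has
cardinality `≤ c`; finiteness of `Xq_tors` (the `ℤ`-torsion) and of `H/R∙κ₁`; and the error-free DVR
Kolyvagin bound in structure form `#Xq_tors ≤ #(H/R∙κ₁)²`. NOT a definition of specialised Selmer groups;
nothing is asserted by declaring this structure. [cite: Howard2004HeegnerKolyvagin, Thm. 1.6.1 and proof of Thm. 2.2.10 (𝔮 = T^m + p)]
[cite: MastellaZerman2026, Thm. 2.40] -/
structure SpecWitness (R : Type u) [CommRing R] (S : Type v) (X : Type w) [AddCommGroup S] [Module R S]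
    [AddCommGroup X] [Module R X] (L : Submodule R S) (q : R) (c : ℕ) where
  /-- the compact specialised Selmer module (`H¹_ℱ(K, T ⊗ R/q)` in the intended construction). -/
  H : Type
  /-- `H` is an abelian group. -/
  [addCommGroupH : AddCommGroup H]
  /-- `H` is an `R`-module. -/
  [moduleH : Module R H]
  /-- the (Pontryagin dual of the) discrete specialised Selmer module. -/
  Xq : Type
  /-- `Xq` is an abelian group. -/
  [addCommGroupXq : AddCommGroup Xq]
  /-- `Xq` is an `R`-module. -/
  [moduleXq : Module R Xq]
  /-- the specialised (stabilised Heegner–Kolyvagin) class `κ_q(1)`. -/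
  κ₁ : H
  /-- compact control `S → H`. -/
  f : S →ₗ[R] H
  /-- dual discrete control `X/qX → Xq`. -/
  h : (X ⧸ ((Ideal.span {q} : Ideal R) • (⊤ : Submodule R X))) →ₗ[R] Xq
  /-- `H` is killed by `q`. -/
  smul_top_eq_bot : (Ideal.span {q} : Ideal R) • (⊤ : Submodule R H) = ⊥
  /-- `f` maps `L` into the line of `κ₁`. -/
  map_le : L.map f ≤ R ∙ κ₁
  /-- (S1-i) the cokernel of the compact control is finite … -/
  finite_coker : Finite (H ⧸ LinearMap.range f)
  /-- … of cardinality `≤ c`. -/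
  card_coker_le : Nat.card (H ⧸ LinearMap.range f) ≤ c
  /-- (S1-ii) the kernel of the discrete control is finite … -/
  finite_ker : Finite (LinearMap.ker h)
  /-- … of cardinality `≤ c`. -/
  card_ker_le : Nat.card (LinearMap.ker h) ≤ c
  /-- `Xq_tors` (the `ℤ`-torsion subgroup) is finite. -/
  finite_torsion : Finite (AddCommGroup.torsion Xq)
  /-- `H / R∙κ₁` is finite (`κ₁` non-torsion in the rank-one `H`). -/
  finite_quot : Finite (H ⧸ (R ∙ κ₁))
  /-- (S2) the error-free DVR Kolyvagin bound, structure form: `#Xq_tors ≤ #(H/R∙κ₁)²`. -/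
  card_torsion_le_sq : Nat.card (AddCommGroup.torsion Xq) ≤ Nat.card (H ⧸ (R ∙ κ₁)) ^ 2

/-! ## The pointwise predicate `HasSpecWitnesses` -/

/-- **`HasSpecWitnesses p S X L`** (pointwise, frame-free, module-level): for the `Λ`-modules `S ⊇ L` and `X`
there are `c, m₀` such that for every `m ≥ m₀` a `SpecWitness` at Howard's Eisenstein prime `q_m = T^m + p`
with control constant `p^c` exists (`c` UNIFORM in `m`). Exactly the hypothesis `hW` of the proofs file's
`exists_card_bound_of_specWitnesses`; bsd-idea-16 g5's pointwise cut. A statement abbreviation (NOT asserted,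
NOT a named fact, no citation tag: it is the cell's beyond-print residual in witness form, cf. Howard 2004 proof of
Thm. 2.2.10 at `𝔮 = T^m + p` and Mastella–Zerman 2026 Thm. 2.40 for the shape of the fields). -/
abbrev HasSpecWitnesses (p : ℕ) [Fact p.Prime] (S : Type v) (X : Type w) [AddCommGroup S]
    [Module (IwasawaAlgebra p) S] [AddCommGroup X] [Module (IwasawaAlgebra p) X]
    (L : Submodule (IwasawaAlgebra p) S) : Prop :=
  ∃ c m₀ : ℕ, ∀ m : ℕ, m₀ ≤ m →
    Nonempty (SpecWitness (IwasawaAlgebra p) S X L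
      (PowerSeries.X ^ m + PowerSeries.C (p : ℤ_[p]) : IwasawaAlgebra p) (p ^ c))

/-- Unfolding lemma (`Iff.rfl`). [folklore] -/
theorem hasSpecWitnesses_iff (p : ℕ) [Fact p.Prime] (S : Type v) (X : Type w) [AddCommGroup S]
    [Module (IwasawaAlgebra p) S] [AddCommGroup X] [Module (IwasawaAlgebra p) X]
    (L : Submodule (IwasawaAlgebra p) S) :
    HasSpecWitnesses p S X L ↔
      ∃ c m₀ : ℕ, ∀ m : ℕ, m₀ ≤ m →
        Nonempty (SpecWitness (IwasawaAlgebra p) S X L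
          (PowerSeries.X ^ m + PowerSeries.C (p : ℤ_[p]) : IwasawaAlgebra p) (p ^ c)) :=
  Iff.rfl

/-! ## The three quantifier shells (one per candidate letter of the shared μ-item) -/

/-- **Shell for the `∀ C` letter** (`MuPartStabilizedOfPrint`, p625984): under EXACTLY its binders (CGLS
`Thm413Hypotheses`, non-CM, (irr), (irr_K), MZ scalars, `p` split, `p ∣ h_K`; `D`, `C`, `X` with `𝔖`, `𝒳` f.g.
and `𝔖/Λκ_∞(C)` torsion): `HasSpecWitnesses p 𝔖 𝒳 Λκ_∞(C)`. Transcribed from bsd-idea-16's card v7/v8 §8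
(`Stmt.specWitnessesFrameFree`). A statement abbreviation; NOT asserted, NOT a named fact, no citation tag
(beyond-print residual of the cell, not a published result). -/
abbrev SpecWitnessesFrameFree : Prop :=
  ∀ (N : ℕ) [NeZero N] (W : WeierstrassCurve ℚ) [W.IsGloballyMinimal] (K : Type) [Field K] [NumberField K]
    (p : ℕ) [Fact p.Prime] (κ : ZpExtension K p) (γ : Field.absoluteGaloisGroup K)
    (jbar : AlgebraicClosure K →+* ℂ),
    CastellaGrossiLeeSkinner2022.Thm413Hypotheses N W K p κ γ →
    ¬ W.HasCM → W.HasIrreducibleModPGaloisRep p → (W.baseChange K).HasIrreducibleModPGaloisRep p →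
    MastellaZerman2026.HasPadicScalarImage W p → SatisfiesHeegnerHypothesis p K →
    p ∣ NumberField.classNumber K →
    ∀ (D : (W.baseChange K).LambdaAdicSelmerData κ γ)
      (C : CastellaGrossiLeeSkinner2022.StabilizedHeegnerData N W K κ jbar)
      (X : (W.baseChange K).SelmerDualData κ γ),
    Module.Finite (IwasawaAlgebra p) D.S → Module.Finite (IwasawaAlgebra p) X.X →
    Module.IsTorsion (IwasawaAlgebra p) (D.S ⧸ CastellaGrossiLeeSkinner2022.stabilizedHeegnerModule D C) →
    HasSpecWitnesses p D.S X.X (CastellaGrossiLeeSkinner2022.stabilizedHeegnerModule D C)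

/-- **Shell for the coherent-pair letter L∃** (`MuPartStabilizedCoherentPair`, p630902; ENDORSED as the shared
crux text by the μ-LEAD x9-p1 g2, 11:53:02Z): same prefix, plus `p ∤ N` and the engine's two tower inputs;
for every `(Dt, β, D, X)` THERE ARE a stabilised datum `C` and a Howard family `F` on `(Dt, β)` with
`ℋ_∞(F) ≤ Λκ_∞(C)`, `g • Λκ_∞(C) ≤ ℋ_∞(F)` (`g ≠ 0`), and — for `𝔖`, `𝒳` f.g., `𝔖/Λκ_∞(C)` torsion —
`HasSpecWitnesses p 𝔖 𝒳 Λκ_∞(C)` AT THAT `C`. The D1 constructor runs on the port's OWN principal system at the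
`C` it builds (no `∀ C` transfer debt). A statement abbreviation; NOT asserted, NOT a named fact, no citation
tag (beyond-print residual of the cell, not a published result). -/
abbrev SpecWitnessesCoherentPair : Prop :=
  ∀ (N : ℕ) [NeZero N] (W : WeierstrassCurve ℚ) [W.IsGloballyMinimal] (K : Type) [Field K] [NumberField K]
    (p : ℕ) [Fact p.Prime] (κ : ZpExtension K p) (γ : Field.absoluteGaloisGroup K)
    (jbar : AlgebraicClosure K →+* ℂ),
    CastellaGrossiLeeSkinner2022.Thm413Hypotheses N W K p κ γ →
    ¬ W.HasCM → W.HasIrreducibleModPGaloisRep p → (W.baseChange K).HasIrreducibleModPGaloisRep p →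
    MastellaZerman2026.HasPadicScalarImage W p → SatisfiesHeegnerHypothesis p K →
    p ∣ NumberField.classNumber K →
    ¬ p ∣ N →
    (∀ k, ringClassSubgroup K (p ^ (k + 1)) jbar ≤ κ.layerSubgroup k) →
    Nat.card (ringClassGalOver (jbar.comp (algebraMap K (AlgebraicClosure K))) p 1) = p - 1 →
    ∀ (Dt : ModularForms.ModularParametrizationData W N) (β : ℤ), (4 * N : ℤ) ∣ β ^ 2 - NumberField.discr K →
    ∀ (D : (W.baseChange K).LambdaAdicSelmerData κ γ) (X : (W.baseChange K).SelmerDualData κ γ),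
    ∃ (C : CastellaGrossiLeeSkinner2022.StabilizedHeegnerData N W K κ jbar) (F : HeegnerFamily N W K κ jbar),
      C.Dt = Dt ∧ F.Dt = Dt ∧ C.β = β ∧ F.β = β ∧
      heegnerModule D F ≤ CastellaGrossiLeeSkinner2022.stabilizedHeegnerModule D C ∧
      (∃ g : IwasawaAlgebra p, g ≠ 0 ∧
        g • CastellaGrossiLeeSkinner2022.stabilizedHeegnerModule D C ≤ heegnerModule D F) ∧
      (Module.Finite (IwasawaAlgebra p) D.S → Module.Finite (IwasawaAlgebra p) X.X →
        Module.IsTorsion (IwasawaAlgebra p)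
          (D.S ⧸ CastellaGrossiLeeSkinner2022.stabilizedHeegnerModule D C) →
        HasSpecWitnesses p D.S X.X (CastellaGrossiLeeSkinner2022.stabilizedHeegnerModule D C))

/-- **Shell for the principal-system letter LP** (`MuPartStabilizedPrincipal`, p630902): same prefix, the
datum `C` BUILT ON a principal `p`-power system `x` (Gross's points of orientation `C.β` for `C.Dt`, fixed by
`Gal(K̄/K[p^j])`) with transversals `A_k` exhibiting `u_k`, `v_k` as `A_k`-norms; conclusion
`HasSpecWitnesses p 𝔖 𝒳 Λκ_∞(C)` for `𝔖`, `𝒳` f.g. and `𝔖/Λκ_∞(C)` torsion. A statement abbreviation; NOT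
asserted, NOT a named fact, no citation tag (beyond-print residual of the cell, not a published result). -/
abbrev SpecWitnessesPrincipal : Prop :=
  ∀ (N : ℕ) [NeZero N] (W : WeierstrassCurve ℚ) [W.IsGloballyMinimal] (K : Type) [Field K] [NumberField K]
    (p : ℕ) [Fact p.Prime] (κ : ZpExtension K p) (γ : Field.absoluteGaloisGroup K)
    (jbar : AlgebraicClosure K →+* ℂ),
    CastellaGrossiLeeSkinner2022.Thm413Hypotheses N W K p κ γ →
    ¬ W.HasCM → W.HasIrreducibleModPGaloisRep p → (W.baseChange K).HasIrreducibleModPGaloisRep p →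
    MastellaZerman2026.HasPadicScalarImage W p → SatisfiesHeegnerHypothesis p K →
    p ∣ NumberField.classNumber K →
    ∀ (D : (W.baseChange K).LambdaAdicSelmerData κ γ)
      (C : CastellaGrossiLeeSkinner2022.StabilizedHeegnerData N W K κ jbar)
      (X : (W.baseChange K).SelmerDualData κ γ)
      (x : ℕ → WeierstrassCurve.geomPoints (W.baseChange K))
      (A : ℕ → Finset (Field.absoluteGaloisGroup K)),
    (∀ j, complexPoint W jbar (x j) =
      ModularForms.heegnerPointComplexOfConductor C.Dt (NumberField.discr K) C.β (p ^ j)) →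
    (∀ j, ∀ σ ∈ ringClassSubgroup K (p ^ j) jbar, σ • x j = x j) →
    (∀ k, (∀ a ∈ A k, a ∈ κ.layerSubgroup k) ∧
      ∀ τ ∈ κ.layerSubgroup k, ∃! a, a ∈ A k ∧ a⁻¹ * τ ∈ ringClassSubgroup K (p ^ C.d k) jbar) →
    (∀ k, C.u k = ∑ a ∈ A k, a • x (C.d k)) → (∀ k, C.v k = ∑ a ∈ A k, a • x (C.d k - 1)) →
    Module.Finite (IwasawaAlgebra p) D.S → Module.Finite (IwasawaAlgebra p) X.X →
    Module.IsTorsion (IwasawaAlgebra p) (D.S ⧸ CastellaGrossiLeeSkinner2022.stabilizedHeegnerModule D C) →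
    HasSpecWitnesses p D.S X.X (CastellaGrossiLeeSkinner2022.stabilizedHeegnerModule D C)

end Summit.BirchSwinnertonDyer.BirchSwinnertonDyer.Theorems.HeegnerMuPartStabilized

end
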